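import Mathlib.Tactic
import HarnessLib

/-!
# Kozma–Nitzan's Question 8 — the couplings and cores of BEY-III(2) for every relay count (gen 32)

Support file (`--supports stmt-CriticalPhenomena-4575`, closed crux; independent mathematics on Kozma–Nitzan's Question 8,
arXiv:2401.12397 §5.5 p. 36), prover `prim-ineq-gen-6` (gen 32).  No definitions, no named facts, no sorries; standard axioms.
Memo `run/shared/lean/prim/prim-ineq-gen-6/PROOF-BEY2-G32.md` §4–§5.

The memo proves the merge-induction inequality BEY-III(2) for every first crossing `k` from three couplings inside the observer
block `T₂` — (H1) `v ≤ γ·p` (A-only-good mass against the C-defect probability of the root cluster), (H0) a Chebyshev bound, and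
LEMMA L1 — plus two polynomial cores.  This file certifies: the one-vertex induction step of (H1) (`kH1_step`) and its base
(`kH1_base`); the case analysis of LEMMA L1 given the coupling (H2) `ā·(v/p) ≤ τ` (`kL1_cases`); CORE h (`kL1_h_core`:
the L1 constant is at most ¾); CORE g (`kN3_g_core`: the excess-need residual fits in the L1 slack).
[cite: KozmaNitzan2024, Question 8 (§5.5 p. 36)]
-/

namespace Summit.CriticalPhenomena.PercolationContinuityZ3.Theorems

namespace PocketCert

/-- **(H1) base.**  A single vertex with marks `a ≤ 1`, `c ∈ [0,1]`: `v = a(1−c)`, `u+m = c`, `γ = 1−c`, and `v(1−γ) ≤ γ(u+m)`.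
[cite: KozmaNitzan2024, Question 8 (§5.5 p. 36)] -/
theorem kH1_base (a c : ℝ) (ha1 : a ≤ 1) (hc0 : 0 ≤ c) (hc1 : c ≤ 1) :
    a * (1 - c) * (1 - (1 - c)) ≤ (1 - c) * c := by
  nlinarith [mul_nonneg hc0 (by linarith : (0:ℝ) ≤ 1 - c)]

/-- **(H1) induction step.**  Glue a vertex `(a,c)` (`a ≤ 1`, `c ∈ [0,1]`) with edge weight `σ` on top of a block with statistics
`u', v', m' ≥ 0`, `p' = u'+v'+m'`, root-C-defect probability `γ' ∈ [0,1]` satisfying the hypothesis `v'(1−γ') ≤ γ'(u'+m')`.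
With `m̃ = (1−σ)p' + σm'`, `v = a((1−c)m̃ + σv')`, `u+m = c(m̃ + σu')`, `γ = (1−c) + cσγ'`: `v(1−γ) ≤ γ(u+m)`.
[cite: KozmaNitzan2024, Question 8 (§5.5 p. 36)] -/
theorem kH1_step (a c σ u' v' m' γ' : ℝ) (ha1 : a ≤ 1) (hc0 : 0 ≤ c) (hc1 : c ≤ 1)
    (hs0 : 0 ≤ σ) (hs1 : σ ≤ 1) (hu : 0 ≤ u') (hv : 0 ≤ v') (hm : 0 ≤ m')
    (hg0 : 0 ≤ γ') (hg1 : γ' ≤ 1) (hIH : v' * (1 - γ') ≤ γ' * (u' + m')) :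
    a * ((1 - c) * ((1 - σ) * (u' + v' + m') + σ * m') + σ * v') * (1 - ((1 - c) + c * σ * γ'))
      ≤ ((1 - c) + c * σ * γ') * (c * (((1 - σ) * (u' + v' + m') + σ * m') + σ * u')) := by
  set mt := (1 - σ) * (u' + v' + m') + σ * m' with hmt
  have hmt0 : 0 ≤ mt := by rw [hmt]; positivity
  -- 1 − γ = c(1 − σγ')
  have hid1 : 1 - ((1 - c) + c * σ * γ') = c * (1 - σ * γ') := by ring
  rw [hid1]
  have hsg : 0 ≤ 1 - σ * γ' := by nlinarith [mul_le_mul hs1 hg1 hg0 (by norm_num : (0:ℝ) ≤ 1)]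
  have hX : 0 ≤ (1 - c) * mt + σ * v' := by
    have : 0 ≤ 1 - c := by linarith
    positivity
  -- reduce to a = 1 (the left side is a·X·c(1−σγ') with X ≥ 0)
  have h1 : a * ((1 - c) * mt + σ * v') * (c * (1 - σ * γ'))
      ≤ ((1 - c) * mt + σ * v') * (c * (1 - σ * γ')) := by
    have hY : 0 ≤ ((1 - c) * mt + σ * v') * (c * (1 - σ * γ')) := by positivity
    nlinarith
  -- the key bracket: RHS − LHS(a=1) = cσ·{ m̃γ' + (1−c)u' + cσγ'u' − v'(1−σγ') }
  have hid2 : ((1 - c) + c * σ * γ') * (c * (mt + σ * u')) - ((1 - c) * mt + σ * v') * (c * (1 - σ * γ'))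
      = c * σ * (mt * γ' + (1 - c) * u' + c * σ * γ' * u' - v' * (1 - σ * γ')) := by ring
  -- the brace is ≥ u'(1−c)(1−σγ') ≥ 0 by the induction hypothesis and p' − v' − m' = u'
  have hbr : 0 ≤ mt * γ' + (1 - c) * u' + c * σ * γ' * u' - v' * (1 - σ * γ') := by
    have e1 : v' * (1 - σ * γ') = v' * (1 - γ') + (1 - σ) * γ' * v' := by ring
    have e2 : mt * γ' = (1 - σ) * (u' + v' + m') * γ' + σ * m' * γ' := by rw [hmt]; ring
    rw [e1, e2]
    have : 0 ≤ u' * (1 - c) * (1 - σ * γ') := by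
      have : 0 ≤ 1 - c := by linarith
      positivity
    nlinarith [mul_nonneg (by linarith : (0:ℝ) ≤ 1 - σ) (mul_nonneg hg0 hu)]
  have h2 : 0 ≤ c * σ * (mt * γ' + (1 - c) * u' + c * σ * γ' * u' - v' * (1 - σ * γ')) := by positivity
  linarith [h1, h2, hid2]

/-- **LEMMA L1, case analysis.**  With `0 < λ`, `C > 0` (`λ' = (1+λ)C − 1`), `ā ≥ 0`, lens `r = v/p`,
badness `τ` with the coupling (H2) `ā·r ≤ τ`: for `X = min((1+λ)C r, λ')`,
`ā(λ(1−λ) + X) ≤ ā(λ(1−λ) + λλ'/(1+λ)) + Cτ`; stated for any `X` below both arguments of the min, multiplied by `1+λ`.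
[cite: KozmaNitzan2024, Question 8 (§5.5 p. 36)] -/
theorem kL1_cases (lam C abar r τ X : ℝ) (hl : 0 < lam) (hC : 0 < C)
    (ha : 0 ≤ abar) (hH2 : abar * r ≤ τ)
    (hX1 : X ≤ (1 + lam) * C * r) (hX2 : X ≤ (1 + lam) * C - 1) :
    (1 + lam) * (abar * (lam * (1 - lam) + X))
      ≤ (1 + lam) * (abar * (lam * (1 - lam))) + abar * lam * ((1 + lam) * C - 1) + (1 + lam) * C * τ := by
  -- (1+λ)·ā·X ≤ ā·X + λ·ā·X ≤ (1+λ)C·ā r + λ ā λ'  ≤ (1+λ)Cτ + λ ā λ'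
  have h1 : abar * X ≤ abar * ((1 + lam) * C * r) := mul_le_mul_of_nonneg_left hX1 ha
  have h2 : abar * X ≤ abar * ((1 + lam) * C - 1) := mul_le_mul_of_nonneg_left hX2 ha
  have h3 : abar * ((1 + lam) * C * r) = (1 + lam) * C * (abar * r) := by ring
  have h4 : (1 + lam) * C * (abar * r) ≤ (1 + lam) * C * τ := by
    apply mul_le_mul_of_nonneg_left hH2; positivity
  nlinarith

/-- **CORE h** (the L1 constant is at most ¾): for `0 < λ` and `C ≤ 1`,
`(1+λ)·λ(1−λ) + λ((1+λ)C − 1) ≤ ¾(1+λ)`, i.e. `h = λ(1−λ) + λλ'/(1+λ) ≤ ¾`.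
[cite: KozmaNitzan2024, Question 8 (§5.5 p. 36)] -/
theorem kL1_h_core (lam C : ℝ) (hl0 : 0 < lam) (hC1 : C ≤ 1) :
    (1 + lam) * (lam * (1 - lam)) + lam * ((1 + lam) * C - 1) ≤ 3 / 4 * (1 + lam) := by
  -- worst case C = 1: λ(1−λ²) + λ² ≤ ¾(1+λ) ⟺ λ³ − λ² − λ/4 + ¾ ≥ 0, and λ³ − λ² − λ/4 + ¾ = (λ − 1)²(λ + 1) + (3 − 5λ)/4 + … ;
  -- direct: nlinarith with the square (λ − 3/4)².
  have h1 : lam * ((1 + lam) * C - 1) ≤ lam * ((1 + lam) * 1 - 1) := by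
    apply mul_le_mul_of_nonneg_left _ hl0.le; nlinarith
  nlinarith [sq_nonneg (lam - 3 / 4), mul_nonneg hl0.le (sq_nonneg (lam - 1))]

/-- **CORE g** (the excess-need residual fits in the L1 slack): for `0 < λ ≤ 1` and every real `C`,
`λ(1+λ)C(1−C) ≤ ¾ − λ(1−λ) − λ((1+λ)C−1)/(1+λ)`, multiplied by `4(1+λ)`; the minimum over `C` is at `C* = (2+λ)/(2(1+λ))`
where the slack is `3 − λ − 4λ² + 3λ³ ≥ 1`.
[cite: KozmaNitzan2024, Question 8 (§5.5 p. 36)] -/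
theorem kN3_g_core (lam C : ℝ) (hl0 : 0 < lam) (hl1 : lam ≤ 1) :
    4 * (1 + lam) * (lam * (1 + lam) * C * (1 - C)) + 4 * (1 + lam) * (lam * (1 - lam)) + 4 * lam * ((1 + lam) * C - 1)
      ≤ 3 * (1 + lam) := by
  -- 4(1+λ)[¾ − h − λ(1+λ)C(1−C)] = 4λ(1+λ)²(C − C*)² + (3 − λ − 4λ² + 3λ³), C* = (2+λ)/(2(1+λ)), and 3 − λ − 4λ² + 3λ³ ≥ 1 on [0,1].
  have hid : 3 * (1 + lam) - (4 * (1 + lam) * (lam * (1 + lam) * C * (1 - C)) + 4 * (1 + lam) * (lam * (1 - lam))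
      + 4 * lam * ((1 + lam) * C - 1))
      = 4 * lam * ((1 + lam) * C - (2 + lam) / 2) ^ 2 + (3 - lam - 4 * lam ^ 2 + 3 * lam ^ 3) := by ring
  have hcub : 1 ≤ 3 - lam - 4 * lam ^ 2 + 3 * lam ^ 3 := by
    -- 2 − λ − 4λ² + 3λ³ = (1 − λ)(2 + λ − 3λ²) = (1−λ)(1−λ)(2+3λ) ≥ 0
    nlinarith [mul_nonneg (mul_nonneg (by linarith : (0:ℝ) ≤ 1 - lam) (by linarith : (0:ℝ) ≤ 1 - lam))
      (by linarith : (0:ℝ) ≤ 2 + 3 * lam)]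
  have hsq : 0 ≤ 4 * lam * ((1 + lam) * C - (2 + lam) / 2) ^ 2 := by positivity
  linarith [hid, hcub, hsq]

end PocketCert

end Summit.CriticalPhenomena.PercolationContinuityZ3.Theorems
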